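import Summits.ResolutionOfSingularities.ResolutionOfSingularities.Theorems.HomologicalConductorNoZenoRBlowupNormalOfCompletePowers
import Summits.ResolutionOfSingularities.ResolutionOfSingularities.Theorems.HomologicalConductorNoZenoRLipman41Of81
import Literature.AlgebraicGeometry.Resolution.Lipman1969QuadraticTransformNormal
import Literature.RingTheory.IntegralClosure.IntegralClosureIdealRemarks
import HarnessLib

/-!
# Crux `NoZenoR` (stmt-ResolutionOfSingularities-19943) — the W3 print `Lipman1969_8_1` from the print «Lipman (7.1)»:
# `Lipman1969_8_1 ⟸ Lipman1969_7_1` (products of complete ideals) — Lipman's own proof of Proposition (8.1)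

Route `ResolutionOfSingularities/HomologicalConductor` (cell decomp-res, hand leafhand-res-homologicalconduct-22 g0).
OURS: AI-written bookkeeping, weaker than expert review; nothing here is a statement of the manuscript under review
(Hironaka 2017).  SUPPORT level, counted 0.  Def-free.

Lipman proves Proposition (8.1) («quadratic transforms of a normal surface with rational singularities are normal») in
two printed lines (p. 212): «The first assertion follows from Theorem (7.1) and Lemma (5.2). […] The surface obtained by
blowing up `y` is `Proj(⊕ 𝔪ⁿ)`.  But it follows easily from the definitions that `𝔪` is complete.»  This file types that
proof:

* `forall_mem_maximalIdeal_of_integralDependence` — «`𝔪` is complete»: the maximal ideal (indeed every prime ideal) is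
  integrally closed (Huneke–Swanson Remark 1.1.3 (4), tree `mem_of_integralDependence_of_isPrime`);
* `forall_mem_pow_maximalIdeal_of_integralDependence_of_7_1` — GIVEN the named fact `Lipman1969_7_1` (Theorem (7.1),
  local form: products of complete ideals of a two-dimensional normal local domain with a rational singularity are
  complete), every power `𝔪ⁿ` is complete, by induction on `n`;
* `Lipman1969_8_1_of_7_1` — **`Lipman1969_8_1 ⟸ Lipman1969_7_1`**, by Lemma (5.2) in its affine normal form
  (`affineBlowup.isIntegrallyClosed_stalk_of_forall_pow`, this hand, fact-free);
* `Lipman1969_4_1_of_7_1` — hence, with hand 21's `Lipman1969_4_1_of_8_1`, the W3 print `Lipman1969_4_1` (minimal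
  desingularization) follows from Theorem (7.1) ALONE (conditional-result).

Net effect on the crux chain's print debt: `Lipman1969_4_1 ⟸ Lipman1969_8_1 ⟸ Lipman1969_7_1`; what remains of (8.1) is
the genuinely cohomological Theorem (7.1) (⟸ Thm (7.2) + Prop. (6.2) + Prop. (1.2) B), pp. 207–211).

No crux, kill test or summit statement is proved here; resolution in positive characteristic is NOT proved.

References: J. Lipman, *Rational singularities, with applications to algebraic surfaces and unique factorization*, Publ.
Math. IHÉS 36 (1969): Lemma (5.2) (p. 206), Theorem (7.1) (p. 209), Proposition (8.1) and its proof (p. 212)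
[`Lipman1969`]; C. Huneke, I. Swanson, *Integral Closure of Ideals, Rings, and Modules* (2006), Remark 1.1.3 (4)
[`HunekeSwanson2006`].
-/

noncomputable section

-- single-problem summit: the doubled namespace component `ResolutionOfSingularities` is forced
set_option linter.dupNamespace false

open CategoryTheory AlgebraicGeometry TopologicalSpace IsLocalRing
open Literature.AlgebraicGeometry.Resolution Literature.RingTheory.IntegralClosure

namespace Summit.ResolutionOfSingularities.ResolutionOfSingularities.Theorems.NoZeno.QuadraticTransform

universe u

/-- **«`𝔪` is complete»** (Lipman, proof of (8.1), p. 212: «it follows easily from the definitions that `𝔪` is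
complete»): the maximal ideal of a local ring is integrally closed — every prime ideal is (Huneke–Swanson,
Remark 1.1.3 (4): `Ī ⊆ √I`). [cite: Lipman1969, Proposition (8.1), proof (p. 212)] -/
theorem forall_mem_maximalIdeal_of_integralDependence {R : Type u} [CommRing R] [IsLocalRing R] (r : R)
    (hr : ∃ (k : ℕ) (c : ℕ → R), (∀ j ∈ Finset.Icc 1 k, c j ∈ maximalIdeal R ^ j) ∧
      r ^ k + ∑ j ∈ Finset.Icc 1 k, c j * r ^ (k - j) = 0) :
    r ∈ maximalIdeal R :=
  mem_of_integralDependence_of_isPrime (maximalIdeal.isMaximal R).isPrime hr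

/-- **Every power `𝔪ⁿ` of the maximal ideal of a two-dimensional normal local domain with a rational singularity is
complete**, GIVEN Theorem (7.1) (products of complete ideals are complete): induction on `n` from «`𝔪` is complete»
(`𝔪⁰ = R` is trivially complete). [cite: Lipman1969, Theorem (7.1) (p. 209); Proposition (8.1), proof (p. 212)] -/
theorem forall_mem_pow_maximalIdeal_of_integralDependence_of_7_1 (h71 : Lipman1969_7_1.{u})
    {R : Type u} [CommRing R] [IsNoetherianRing R] [IsLocalRing R] [IsDomain R] [IsIntegrallyClosed R]
    (hdim : ringKrullDim R = 2) (hrat : HasRationalSingularity R) (n : ℕ) (r : R)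
    (hr : ∃ (k : ℕ) (c : ℕ → R), (∀ j ∈ Finset.Icc 1 k, c j ∈ (maximalIdeal R ^ n) ^ j) ∧
      r ^ k + ∑ j ∈ Finset.Icc 1 k, c j * r ^ (k - j) = 0) :
    r ∈ maximalIdeal R ^ n := by
  induction n generalizing r with
  | zero => rw [pow_zero, Ideal.one_eq_top]; exact Submodule.mem_top
  | succ n ih =>
    rw [pow_succ] at hr ⊢
    exact h71 R hdim hrat (maximalIdeal R ^ n) (maximalIdeal R) ih
      (forall_mem_maximalIdeal_of_integralDependence) r hr

/-- **`Lipman1969_8_1 ⟸ Lipman1969_7_1`** — Lipman's own proof of Proposition (8.1) (p. 212: «The first assertion follows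
from Theorem (7.1) and Lemma (5.2) … it follows easily from the definitions that `𝔪` is complete»): all powers `𝔪ⁿ` are
complete (`forall_mem_pow_maximalIdeal_of_integralDependence_of_7_1`), so every local ring of the quadratic transform
`Bl_𝔪(Spec R) = Proj(⊕ 𝔪ⁿ)` is an integrally closed domain by Lemma (5.2)
(`affineBlowup.isIntegrallyClosed_stalk_of_forall_pow`, fact-free).  CONDITIONAL on the named fact `Lipman1969_7_1`.
[cite: Lipman1969, Proposition (8.1) and its proof (p. 212); Lemma (5.2) (p. 206); Theorem (7.1) (p. 209)] -/
theorem Lipman1969_8_1_of_7_1 (h71 : Lipman1969_7_1.{u}) : Lipman1969_8_1.{u} := by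
  intro R _ _ _ _ _ hdim hrat y
  exact affineBlowup.isIntegrallyClosed_stalk_of_forall_pow (maximalIdeal R)
    (forall_mem_pow_maximalIdeal_of_integralDependence_of_7_1 h71 hdim hrat) y

/-- **`Lipman1969_4_1 ⟸ Lipman1969_7_1`** (universe `0`): the W3 print «minimal desingularization of a normal surface with
finitely many rational singular points» follows from Theorem (7.1) alone, through (8.1) (`Lipman1969_8_1_of_7_1`) and
hand 21's assembly of Lipman's proof of Theorem (4.1) (`Lipman1969_4_1_of_8_1`).  CONDITIONAL on `Lipman1969_7_1`.
[cite: Lipman1969, Theorem (4.1) (p. 204), Theorem (7.1) (p. 209), Proposition (8.1) (p. 212)] -/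
theorem Lipman1969_4_1_of_7_1 (h71 : Lipman1969_7_1.{0}) : Lipman1969_4_1.{0} :=
  Lipman1969_4_1_of_8_1 (Lipman1969_8_1_of_7_1 h71)

/-- **The consumed local form from (7.1)**: a two-dimensional normal Noetherian local domain with a rational singularity
has a minimal desingularization of `Spec S` which is a blowing up along a centre cosupported at the closed point, GIVEN
Theorem (7.1). [cite: Lipman1969, Theorem (4.1) (p. 204); Theorem (7.1) (p. 209)] -/
theorem exists_isMinimalResolution_isBlowup_of_7_1 (h71 : Lipman1969_7_1.{0}) {S : Type} [CommRing S]
    [IsNoetherianRing S] [IsLocalRing S] [IsDomain S] [IsIntegrallyClosed S] (hdim : ringKrullDim S = 2)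
    (hrat : HasRationalSingularity S) :
    ∃ (X₀ : Scheme.{0}) (f : X₀ ⟶ Spec (.of S)) (J : (Spec (.of S)).IdealSheafData),
      IsMinimalResolution f ∧ IsBlowup f J ∧ (J.support : Set (Spec (.of S))) ⊆ {closedPoint S} :=
  exists_isMinimalResolution_isBlowup_of_8_1 (Lipman1969_8_1_of_7_1 h71) hdim hrat

end Summit.ResolutionOfSingularities.ResolutionOfSingularities.Theorems.NoZeno.QuadraticTransform

end
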